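import Mathlib.Analysis.SpecialFunctions.Pow.Deriv
import Mathlib.Analysis.Convex.SpecificFunctions.Basic
import Literature.Analysis.FluidPDE.EnstrophyGronwall

/-!
# Weighted `L^{5/2}` vorticity slice inequality: pointwise tools — crux
stmt-NavierStokesRegularity-2882 (`TypeICertificateLadder.RungReynoldsOne`), line
`lp-vorticity-young-budget`, stub `stub_weightedVorticitySlice`

Helper file (theorems only) for the stub `stub_weightedVorticitySlice` (the weighted `L^{5/2}`
vorticity budget at one time, main file `…RungReynoldsOneWeightedSlice.lean`). Everything here is
pointwise calculus and algebra for the smooth weight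

* `wt(y) = (‖y‖² + 1)^{1/4}`, the weighted field `Φ(y) = wt(y) y` and the convex potential
  `F(y) = (‖y‖² + 1)^{5/4} − 1` (`∇F = (5/2) wt(y) y`), composed with a `C¹` field `w : ℝ³ → ℝ³`:
  the chain rules `D(F∘w) u = (5/2) wt ⟪w, Dw u⟫`,
  `D(Φ∘w) u = wt • Dw u + (wt / (2(‖w‖²+1))) ⟪w, Dw u⟫ • w`, the product rule for `wⱼ Φ(w)`,
  and the elementary bounds `‖Φ(y)‖ = wt ‖y‖`, `‖DΦ u‖ ≤ (3/2) wt ‖Dw u‖`, `1 ≤ wt ≤ ‖y‖² + 1`,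
  `0 ≤ F(y) ≤ (5/4) wt ‖y‖²` (Bernoulli);
* the **pointwise Young budget** `pointwise_budget`: for a linear map `L` (the vorticity gradient),
  vectors `y` (the vorticity) and `V` (the velocity),
  `−(ν Σᵢ ⟪L eᵢ, DΦ_y(L eᵢ)⟫ + ⟪DΦ_y(L y), V⟫) ≤ (3/(8ν)) ‖V‖² wt ‖y‖²`,
  i.e. the stretching density integrated by parts onto the velocity is absorbed by the two
  non-negative pieces `wt Σᵢ‖L eᵢ‖²` and `(wt/(2(‖y‖²+1))) Σᵢ⟪y, L eᵢ⟫²` of the weighted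
  dissipation, with the sharp factor `(1 + 1/2)/4 = 3/8`;
* two `L²` bookkeeping lemmas (`∫⁻ ‖a‖ₑ² < ∞` under `‖a‖ ≤ C‖b‖`; integrability under
  `‖φ‖ ≤ C ‖a‖ ‖b‖` with `a, b` continuous and square integrable).

Sources: the computation is the `q = 5/2` case of the `L^q`-vorticity budget behind the
Beirão da Veiga / Berselli-type criteria (H. Beirão da Veiga, *Chinese Ann. Math. Ser. B* 16
(1995), §2), written with a smooth weight; all lemmas are elementary. [folklore]
-/

noncomputable section

open Set Filter Topology MeasureTheory
open scoped RealInnerProductSpace ENNReal NNReal Laplacian ContDiff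
open Literature.Analysis.FluidPDE

namespace Summit.NavierStokesRegularity.NavierStokesRegularity.Theorems.RungReynoldsOne

-- the problem directory repeats the summit name (`NavierStokesRegularity/NavierStokesRegularity`)
set_option linter.dupNamespace false

namespace WeightedSlice

/-! ### Elementary real inequalities -/

/-- Completing the square: `−νK² + Kc ≤ c²/(4ν)` for `ν > 0`. [folklore] -/
theorem neg_mul_sq_add_mul_le {ν : ℝ} (hν : 0 < ν) (K c : ℝ) :
    -(ν * K ^ 2) + K * c ≤ c ^ 2 / (4 * ν) := by
  have h : c ^ 2 / (4 * ν) - (-(ν * K ^ 2) + K * c) = (2 * ν * K - c) ^ 2 / (4 * ν) := by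
    field_simp
    ring
  have h' : 0 ≤ (2 * ν * K - c) ^ 2 / (4 * ν) := by positivity
  linarith

/-- **The two Young absorptions of the weighted vorticity budget, in real variables.** With
`τ = w / (2(r²+1))` (`w ≥ 0` the weight at vorticity size `r`), `K² ≤ A`, `|X| ≤ K r a`,
`|Y| ≤ r P`, `|Z| ≤ r a`:
`−(ν (w A + τ P²) + (w X + τ Y Z)) ≤ (3/(8ν)) a² w r²`
(`w(Kra − νA) ≤ w r²a²/(4ν)`, `τ(r²aP − νP²) ≤ τ r⁴a²/(4ν)` and `τ r² ≤ w/2`). [folklore] -/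
theorem young_absorb {ν w r a K A P X Y Z : ℝ} (hν : 0 < ν) (hw : 0 ≤ w) (hr : 0 ≤ r)
    (hP : 0 ≤ P) (hKA : K ^ 2 ≤ A) (hX : |X| ≤ K * r * a) (hY : |Y| ≤ r * P)
    (hZ : |Z| ≤ r * a) :
    -(ν * (w * A + w / (2 * (r ^ 2 + 1)) * P ^ 2) +
        (w * X + w / (2 * (r ^ 2 + 1)) * (Y * Z))) ≤
      3 / (8 * ν) * (a ^ 2 * (w * r ^ 2)) := by
  have hρ : 0 < r ^ 2 + 1 := by positivity
  set τ := w / (2 * (r ^ 2 + 1)) with hτ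
  have hτ0 : 0 ≤ τ := by positivity
  -- first absorption
  have h1 : -(ν * (w * A)) - w * X ≤ w * ((r * a) ^ 2 / (4 * ν)) := by
    have hX' : -X ≤ K * (r * a) := by
      rw [← mul_assoc]
      exact (neg_le_abs X).trans hX
    have hq := neg_mul_sq_add_mul_le hν K (r * a)
    have hKA' : ν * K ^ 2 ≤ ν * A := mul_le_mul_of_nonneg_left hKA hν.le
    have key : -(ν * A) - X ≤ (r * a) ^ 2 / (4 * ν) := by linarith
    have h := mul_le_mul_of_nonneg_left key hw
    have e : w * (-(ν * A) - X) = -(ν * (w * A)) - w * X := by ring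
    linarith
  -- second absorption
  have h2 : -(ν * (τ * P ^ 2)) - τ * (Y * Z) ≤ τ * ((r ^ 2 * a) ^ 2 / (4 * ν)) := by
    have hYZ : -(Y * Z) ≤ P * (r ^ 2 * a) := by
      have h0 : -(Y * Z) ≤ |Y| * |Z| := by
        rw [← abs_mul]
        exact neg_le_abs _
      have h0' : |Y| * |Z| ≤ (r * P) * (r * a) :=
        mul_le_mul hY hZ (abs_nonneg _) (by positivity)
      have e : (r * P) * (r * a) = P * (r ^ 2 * a) := by ring
      linarith
    have hq := neg_mul_sq_add_mul_le hν P (r ^ 2 * a)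
    have key : -(ν * P ^ 2) - Y * Z ≤ (r ^ 2 * a) ^ 2 / (4 * ν) := by linarith
    have h := mul_le_mul_of_nonneg_left key hτ0
    have e : τ * (-(ν * P ^ 2) - Y * Z) = -(ν * (τ * P ^ 2)) - τ * (Y * Z) := by ring
    linarith
  -- comparison of the two weights
  have h3 : τ * r ^ 2 ≤ w / 2 := by
    rw [hτ, div_mul_eq_mul_div, div_le_div_iff₀ (by positivity) (by norm_num)]
    nlinarith
  -- combine
  have h4 : w * ((r * a) ^ 2 / (4 * ν)) + τ * ((r ^ 2 * a) ^ 2 / (4 * ν)) ≤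
      3 / (8 * ν) * (a ^ 2 * (w * r ^ 2)) := by
    have e1 : τ * ((r ^ 2 * a) ^ 2 / (4 * ν)) = (τ * r ^ 2) * (r ^ 2 * a ^ 2 / (4 * ν)) := by ring
    have hnn : 0 ≤ r ^ 2 * a ^ 2 / (4 * ν) := by positivity
    have e2 := mul_le_mul_of_nonneg_right h3 hnn
    have e3 : w * ((r * a) ^ 2 / (4 * ν)) + w / 2 * (r ^ 2 * a ^ 2 / (4 * ν)) =
        3 / (8 * ν) * (a ^ 2 * (w * r ^ 2)) := by
      field_simp
      ring
    linarith
  have e : -(ν * (w * A + τ * P ^ 2) + (w * X + τ * (Y * Z))) =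
      (-(ν * (w * A)) - w * X) + (-(ν * (τ * P ^ 2)) - τ * (Y * Z)) := by ring
  linarith

/-! ### The pointwise Young budget -/

/-- **Pointwise Young budget.** For a linear map `L : ℝ³ → ℝ³` (the vorticity gradient `Dω(x)`),
vectors `y` (the vorticity `ω(x)`) and `V` (the velocity `u(x)`), weight
`wt = (‖y‖² + 1)^{1/4}` and `τ = wt / (2(‖y‖²+1))` (so that
`DΦ_y h = wt h + τ ⟪y, h⟫ y` for `Φ(y) = wt(y) y`):
`−(ν Σᵢ ⟪L eᵢ, wt L eᵢ + τ⟪y, L eᵢ⟫ y⟫ + ⟪wt L y + τ ⟪y, L y⟫ y, V⟫) ≤ (3/(8ν)) ‖V‖² wt ‖y‖²`.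
Proof: `Σᵢ ⟪L eᵢ, DΦ(L eᵢ)⟫ = wt Σᵢ‖L eᵢ‖² + τ Σᵢ⟪y, L eᵢ⟫²`, Cauchy–Schwarz
`‖L y‖ ≤ ‖L‖ ‖y‖`, `‖L‖² ≤ Σᵢ ‖L eᵢ‖²`, `⟪y, L y⟫² ≤ ‖y‖² Σᵢ ⟪y, L eᵢ⟫²`, and `young_absorb`.
[folklore] -/
theorem pointwise_budget {ν : ℝ} (hν : 0 < ν)
    (L : EuclideanSpace ℝ (Fin 3) →L[ℝ] EuclideanSpace ℝ (Fin 3)) (y V : EuclideanSpace ℝ (Fin 3)) :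
    -(ν * ∑ i, ⟪L (EuclideanSpace.basisFun (Fin 3) ℝ i),
          (‖y‖ ^ 2 + 1) ^ (1 / 4 : ℝ) • L (EuclideanSpace.basisFun (Fin 3) ℝ i) +
            ((‖y‖ ^ 2 + 1) ^ (1 / 4 : ℝ) / (2 * (‖y‖ ^ 2 + 1)) *
              ⟪y, L (EuclideanSpace.basisFun (Fin 3) ℝ i)⟫) • y⟫ +
        ⟪(‖y‖ ^ 2 + 1) ^ (1 / 4 : ℝ) • L y +
            ((‖y‖ ^ 2 + 1) ^ (1 / 4 : ℝ) / (2 * (‖y‖ ^ 2 + 1)) * ⟪y, L y⟫) • y, V⟫) ≤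
      3 / (8 * ν) * (‖V‖ ^ 2 * ((‖y‖ ^ 2 + 1) ^ (1 / 4 : ℝ) * ‖y‖ ^ 2)) := by
  set e := EuclideanSpace.basisFun (Fin 3) ℝ with he
  set wt := (‖y‖ ^ 2 + 1) ^ (1 / 4 : ℝ) with hwt
  set τ := wt / (2 * (‖y‖ ^ 2 + 1)) with hτ
  set A := ∑ i, ‖L (e i)‖ ^ 2 with hA
  set S := ∑ i, ⟪y, L (e i)⟫ ^ 2 with hS
  set P := Real.sqrt S with hP
  have hwt0 : 0 ≤ wt := Real.rpow_nonneg (by positivity) _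
  have hS0 : 0 ≤ S := Finset.sum_nonneg fun i _ => sq_nonneg _
  have hPS : P ^ 2 = S := Real.sq_sqrt hS0
  have hP0 : 0 ≤ P := Real.sqrt_nonneg _
  -- the weighted dissipation density
  have hvisc : ∑ i, ⟪L (e i), wt • L (e i) + (τ * ⟪y, L (e i)⟫) • y⟫ = wt * A + τ * P ^ 2 := by
    rw [hPS, hA, hS, Finset.mul_sum, Finset.mul_sum, ← Finset.sum_add_distrib]
    refine Finset.sum_congr rfl fun i _ => ?_
    rw [inner_add_right, real_inner_smul_right, real_inner_smul_right, real_inner_self_eq_norm_sq,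
      real_inner_comm y (L (e i))]
    ring
  -- the stretching density
  have hstr : ⟪wt • L y + (τ * ⟪y, L y⟫) • y, V⟫ = wt * ⟪L y, V⟫ + τ * (⟪y, L y⟫ * ⟪y, V⟫) := by
    rw [inner_add_left, real_inner_smul_left, real_inner_smul_left]
    ring
  -- Cauchy–Schwarz
  have hK : ‖L‖ ^ 2 ≤ A := sq_opNorm_le_sum_sq_norm_apply e L
  have hX : |⟪L y, V⟫| ≤ ‖L‖ * ‖y‖ * ‖V‖ :=
    (abs_real_inner_le_norm _ _).trans (mul_le_mul_of_nonneg_right (L.le_opNorm y) (norm_nonneg _))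
  have hZ : |⟪y, V⟫| ≤ ‖y‖ * ‖V‖ := abs_real_inner_le_norm _ _
  have hY : |⟪y, L y⟫| ≤ ‖y‖ * P := by
    have hLy : L y = ∑ i, ⟪e i, y⟫ • L (e i) := by
      conv_lhs => rw [← e.sum_repr' y]
      rw [map_sum]
      simp_rw [map_smul]
    have hexp : ⟪y, L y⟫ = ∑ i, ⟪e i, y⟫ * ⟪y, L (e i)⟫ := by
      rw [hLy, inner_sum]
      simp_rw [real_inner_smul_right]
    have hCS : (∑ i, ⟪e i, y⟫ * ⟪y, L (e i)⟫) ^ 2 ≤ (∑ i, ⟪e i, y⟫ ^ 2) * ∑ i, ⟪y, L (e i)⟫ ^ 2 :=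
      Finset.sum_mul_sq_le_sq_mul_sq _ _ _
    rw [e.sum_sq_inner_right y] at hCS
    refine abs_le_of_sq_le_sq ?_ (by positivity)
    rw [hexp, mul_pow, hPS]
    exact hCS
  rw [hvisc, hstr]
  exact young_absorb hν hwt0 (norm_nonneg y) hP0 hK hX hY hZ

/-! ### The weight, the weighted field and the potential: elementary bounds -/

/-- `1 ≤ (‖y‖² + 1)^{1/4}`. [folklore] -/
theorem one_le_weight {F : Type*} [NormedAddCommGroup F] (y : F) :
    1 ≤ (‖y‖ ^ 2 + 1) ^ (1 / 4 : ℝ) :=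
  Real.one_le_rpow (by nlinarith [sq_nonneg ‖y‖]) (by norm_num)

/-- `(‖y‖² + 1)^{1/4} ≤ ‖y‖² + 1`. [folklore] -/
theorem weight_le {F : Type*} [NormedAddCommGroup F] (y : F) :
    (‖y‖ ^ 2 + 1) ^ (1 / 4 : ℝ) ≤ ‖y‖ ^ 2 + 1 := by
  conv_rhs => rw [← Real.rpow_one (‖y‖ ^ 2 + 1)]
  exact Real.rpow_le_rpow_of_exponent_le (by nlinarith [sq_nonneg ‖y‖]) (by norm_num)

/-- `‖(‖y‖²+1)^{1/4} y‖ = (‖y‖²+1)^{1/4} ‖y‖`. [folklore] -/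
theorem norm_weight_smul {F : Type*} [NormedAddCommGroup F] [NormedSpace ℝ F] (y : F) :
    ‖(‖y‖ ^ 2 + 1) ^ (1 / 4 : ℝ) • y‖ = (‖y‖ ^ 2 + 1) ^ (1 / 4 : ℝ) * ‖y‖ := by
  rw [norm_smul, Real.norm_of_nonneg (Real.rpow_nonneg (by positivity) _)]

/-- `0 ≤ F(y) = (‖y‖²+1)^{5/4} − 1`. [folklore] -/
theorem potential_nonneg {F : Type*} [NormedAddCommGroup F] (y : F) :
    0 ≤ (‖y‖ ^ 2 + 1) ^ (5 / 4 : ℝ) - 1 :=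
  sub_nonneg.2 (Real.one_le_rpow (by nlinarith [sq_nonneg ‖y‖]) (by norm_num))

/-- **`F(y) ≤ (5/4) (‖y‖²+1)^{1/4} ‖y‖²`** for `F(y) = (‖y‖²+1)^{5/4} − 1` (Bernoulli:
`(1 + s)^{1/4} ≤ 1 + s/4`). [folklore] -/
theorem potential_le {F : Type*} [NormedAddCommGroup F] (y : F) :
    (‖y‖ ^ 2 + 1) ^ (5 / 4 : ℝ) - 1 ≤ 5 / 4 * (‖y‖ ^ 2 + 1) ^ (1 / 4 : ℝ) * ‖y‖ ^ 2 := by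
  have hρ : 0 < ‖y‖ ^ 2 + 1 := by positivity
  have hsplit : (‖y‖ ^ 2 + 1) ^ (5 / 4 : ℝ) = (‖y‖ ^ 2 + 1) * (‖y‖ ^ 2 + 1) ^ (1 / 4 : ℝ) := by
    rw [show (5 / 4 : ℝ) = 1 + 1 / 4 by norm_num, Real.rpow_add hρ, Real.rpow_one]
  have hB : (‖y‖ ^ 2 + 1) ^ (1 / 4 : ℝ) ≤ 1 + 1 / 4 * ‖y‖ ^ 2 := by
    have h := rpow_one_add_le_one_add_mul_self (s := ‖y‖ ^ 2) (by nlinarith [sq_nonneg ‖y‖])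
      (p := 1 / 4) (by norm_num) (by norm_num)
    rwa [add_comm (1 : ℝ) (‖y‖ ^ 2)] at h
  set wt := (‖y‖ ^ 2 + 1) ^ (1 / 4 : ℝ) with hwt
  have hwt0 : 0 ≤ wt := Real.rpow_nonneg hρ.le _
  rw [hsplit]
  rcases le_or_gt (‖y‖ ^ 2) 4 with h4 | h4
  · have h0 : (0 : ℝ) ≤ 1 - 1 / 4 * ‖y‖ ^ 2 := by linarith
    nlinarith [mul_le_mul_of_nonneg_right hB h0, sq_nonneg (‖y‖ ^ 2)]
  · have h0 : (0 : ℝ) ≤ 1 / 4 * ‖y‖ ^ 2 - 1 := by linarith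
    nlinarith [mul_nonneg hwt0 h0]

/-- **`‖DΦ_y h‖ ≤ (3/2) wt ‖h‖`** for `DΦ_y h = wt h + (wt/(2(‖y‖²+1))) ⟪y, h⟫ y`,
`wt = (‖y‖²+1)^{1/4}` (since `‖y‖² ≤ ‖y‖² + 1`). [folklore] -/
theorem norm_weightedField_deriv_le {F : Type*} [NormedAddCommGroup F] [InnerProductSpace ℝ F]
    (y h : F) :
    ‖(‖y‖ ^ 2 + 1) ^ (1 / 4 : ℝ) • h +
        ((‖y‖ ^ 2 + 1) ^ (1 / 4 : ℝ) / (2 * (‖y‖ ^ 2 + 1)) * ⟪y, h⟫) • y‖ ≤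
      3 / 2 * (‖y‖ ^ 2 + 1) ^ (1 / 4 : ℝ) * ‖h‖ := by
  have hρ : 0 < ‖y‖ ^ 2 + 1 := by positivity
  set wt := (‖y‖ ^ 2 + 1) ^ (1 / 4 : ℝ) with hwt
  have hwt0 : 0 ≤ wt := Real.rpow_nonneg hρ.le _
  set τ := wt / (2 * (‖y‖ ^ 2 + 1)) with hτ
  have hτ0 : 0 ≤ τ := by positivity
  have h3 : τ * ‖y‖ ^ 2 ≤ wt / 2 := by
    rw [hτ, div_mul_eq_mul_div, div_le_div_iff₀ (by positivity) (by norm_num)]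
    nlinarith
  calc ‖wt • h + (τ * ⟪y, h⟫) • y‖ ≤ ‖wt • h‖ + ‖(τ * ⟪y, h⟫) • y‖ := norm_add_le _ _
    _ = wt * ‖h‖ + τ * |⟪y, h⟫| * ‖y‖ := by
        rw [norm_smul, norm_smul, Real.norm_of_nonneg hwt0, Real.norm_eq_abs, abs_mul,
          abs_of_nonneg hτ0]
    _ ≤ wt * ‖h‖ + τ * (‖y‖ * ‖h‖) * ‖y‖ := by
        gcongr
        exact abs_real_inner_le_norm _ _
    _ = (wt + τ * ‖y‖ ^ 2) * ‖h‖ := by ring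
    _ ≤ (wt + wt / 2) * ‖h‖ := by gcongr
    _ = 3 / 2 * wt * ‖h‖ := by ring

/-! ### Chain rules for the weight composed with a field -/

/-- Chain rule: `D((‖w‖²+1)^p)(x) = 2p (‖w(x)‖²+1)^{p−1} ⟪w(x), Dw(x) ·⟫`. [folklore] -/
theorem hasFDerivAt_rpow_norm_sq_add_one {w : EuclideanSpace ℝ (Fin 3) → EuclideanSpace ℝ (Fin 3)}
    {L : EuclideanSpace ℝ (Fin 3) →L[ℝ] EuclideanSpace ℝ (Fin 3)} {x : EuclideanSpace ℝ (Fin 3)}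
    (hw : HasFDerivAt w L x) (p : ℝ) :
    HasFDerivAt (fun y => (‖w y‖ ^ 2 + 1) ^ p)
      ((2 * p * (‖w x‖ ^ 2 + 1) ^ (p - 1)) • (innerSL ℝ (w x)).comp L) x := by
  have h1 : HasFDerivAt (fun y => ‖w y‖ ^ 2 + 1) (2 • (innerSL ℝ (w x)).comp L) x :=
    hw.norm_sq.add_const 1
  have hpos : (‖w x‖ ^ 2 + 1) ≠ 0 := by positivity
  refine (h1.rpow_const (p := p) (Or.inl hpos)).congr_fderiv ?_
  ext u
  simp only [smul_apply, ContinuousLinearMap.comp_apply, innerSL_apply_apply, smul_eq_mul,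
    nsmul_eq_mul, Nat.cast_ofNat]
  ring

/-- Chain rule for the potential: `D((‖w‖²+1)^{5/4} − 1)(x) u = (5/2) (‖w(x)‖²+1)^{1/4} ⟪w(x), Dw(x) u⟫`.
[folklore] -/
theorem hasFDerivAt_potential {w : EuclideanSpace ℝ (Fin 3) → EuclideanSpace ℝ (Fin 3)}
    {L : EuclideanSpace ℝ (Fin 3) →L[ℝ] EuclideanSpace ℝ (Fin 3)} {x : EuclideanSpace ℝ (Fin 3)}
    (hw : HasFDerivAt w L x) :
    HasFDerivAt (fun y => (‖w y‖ ^ 2 + 1) ^ (5 / 4 : ℝ) - 1)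
      ((5 / 2 * (‖w x‖ ^ 2 + 1) ^ (1 / 4 : ℝ)) • (innerSL ℝ (w x)).comp L) x := by
  have h := (hasFDerivAt_rpow_norm_sq_add_one hw (5 / 4 : ℝ)).sub_const 1
  have e1 : (5 / 4 : ℝ) - 1 = 1 / 4 := by norm_num
  have e2 : (2 : ℝ) * (5 / 4) = 5 / 2 := by norm_num
  rw [e1, e2] at h
  exact h

/-- `fderiv` form of `hasFDerivAt_potential`. [folklore] -/
theorem fderiv_potential_apply {w : EuclideanSpace ℝ (Fin 3) → EuclideanSpace ℝ (Fin 3)}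
    {x : EuclideanSpace ℝ (Fin 3)} (hw : DifferentiableAt ℝ w x) (u : EuclideanSpace ℝ (Fin 3)) :
    fderiv ℝ (fun y => (‖w y‖ ^ 2 + 1) ^ (5 / 4 : ℝ) - 1) x u =
      5 / 2 * (‖w x‖ ^ 2 + 1) ^ (1 / 4 : ℝ) * ⟪w x, fderiv ℝ w x u⟫ := by
  rw [(hasFDerivAt_potential hw.hasFDerivAt).fderiv]
  simp only [smul_apply, ContinuousLinearMap.comp_apply, innerSL_apply_apply, smul_eq_mul]

/-- Chain rule for the weighted field `Φ(w) = (‖w‖²+1)^{1/4} w`: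
`D(Φ∘w)(x) = wt • Dw(x) + (D wt(x)) ⊗ w(x)`. [folklore] -/
theorem hasFDerivAt_weightedField {w : EuclideanSpace ℝ (Fin 3) → EuclideanSpace ℝ (Fin 3)}
    {L : EuclideanSpace ℝ (Fin 3) →L[ℝ] EuclideanSpace ℝ (Fin 3)} {x : EuclideanSpace ℝ (Fin 3)}
    (hw : HasFDerivAt w L x) :
    HasFDerivAt (fun y => (‖w y‖ ^ 2 + 1) ^ (1 / 4 : ℝ) • w y)
      ((‖w x‖ ^ 2 + 1) ^ (1 / 4 : ℝ) • L +
        ((2 * (1 / 4 : ℝ) * (‖w x‖ ^ 2 + 1) ^ ((1 / 4 : ℝ) - 1)) •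
          (innerSL ℝ (w x)).comp L).smulRight (w x)) x :=
  (hasFDerivAt_rpow_norm_sq_add_one hw (1 / 4 : ℝ)).fun_smul hw

/-- **`D(Φ∘w)(x) u = wt • Dw u + (wt / (2(‖w‖²+1))) ⟪w, Dw u⟫ • w`**, `wt = (‖w(x)‖²+1)^{1/4}`.
[folklore] -/
theorem fderiv_weightedField_apply {w : EuclideanSpace ℝ (Fin 3) → EuclideanSpace ℝ (Fin 3)}
    {x : EuclideanSpace ℝ (Fin 3)} (hw : DifferentiableAt ℝ w x) (u : EuclideanSpace ℝ (Fin 3)) :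
    fderiv ℝ (fun y => (‖w y‖ ^ 2 + 1) ^ (1 / 4 : ℝ) • w y) x u =
      (‖w x‖ ^ 2 + 1) ^ (1 / 4 : ℝ) • fderiv ℝ w x u +
        ((‖w x‖ ^ 2 + 1) ^ (1 / 4 : ℝ) / (2 * (‖w x‖ ^ 2 + 1)) * ⟪w x, fderiv ℝ w x u⟫) • w x := by
  have hρ : 0 < ‖w x‖ ^ 2 + 1 := by positivity
  rw [(hasFDerivAt_weightedField hw.hasFDerivAt).fderiv]
  simp only [add_apply, smul_apply, ContinuousLinearMap.smulRight_apply,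
    ContinuousLinearMap.comp_apply, innerSL_apply_apply, smul_eq_mul]
  congr 1
  rw [Real.rpow_sub_one hρ.ne']
  congr 1
  field_simp
  ring

/-- The weighted field of a `C¹` field is differentiable. [folklore] -/
theorem differentiable_weightedField {w : EuclideanSpace ℝ (Fin 3) → EuclideanSpace ℝ (Fin 3)}
    (hw : Differentiable ℝ w) :
    Differentiable ℝ (fun y => (‖w y‖ ^ 2 + 1) ^ (1 / 4 : ℝ) • w y) := fun x =>
  (hasFDerivAt_weightedField (hw x).hasFDerivAt).differentiableAt

/-- Product rule for a coordinate times a field: `D(⟪c, w⟫ Ψ)(x) u = ⟪c, Dw u⟫ Ψ(x) + ⟪c, w(x)⟫ DΨ u`.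
[folklore] -/
theorem fderiv_inner_smul_apply {w Ψ : EuclideanSpace ℝ (Fin 3) → EuclideanSpace ℝ (Fin 3)}
    {x : EuclideanSpace ℝ (Fin 3)} (hw : ContDiff ℝ 1 w) (hΨ : DifferentiableAt ℝ Ψ x)
    (c u : EuclideanSpace ℝ (Fin 3)) :
    fderiv ℝ (fun y => ⟪c, w y⟫ • Ψ y) x u = ⟪c, fderiv ℝ w x u⟫ • Ψ x + ⟪c, w x⟫ • fderiv ℝ Ψ x u := by
  have hc : DifferentiableAt ℝ (fun y => ⟪c, w y⟫) x :=
    (innerSL ℝ c).differentiableAt.comp x ((hw.differentiable one_ne_zero) x)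
  rw [fderiv_fun_smul hc hΨ]
  simp only [add_apply, smul_apply, ContinuousLinearMap.smulRight_apply]
  rw [fderiv_inner_const_left_apply_of_contDiff hw c x u, add_comm]

/-! ### `L²` bookkeeping -/

/-- `∫⁻ ‖a‖ₑ² < ∞` from `‖a‖ ≤ C ‖b‖` pointwise and `∫⁻ ‖b‖ₑ² < ∞`. [folklore] -/
theorem lintegral_enorm_sq_lt_top_of_norm_le_const_mul {α : Type*} [MeasurableSpace α]
    {μ : Measure α} {G₁ G₂ : Type*} [NormedAddCommGroup G₁] [NormedAddCommGroup G₂]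
    {a : α → G₁} {b : α → G₂} (C : ℝ) (h : ∀ x, ‖a x‖ ≤ C * ‖b x‖)
    (hb : ∫⁻ x, ‖b x‖ₑ ^ 2 ∂μ < ⊤) : ∫⁻ x, ‖a x‖ₑ ^ 2 ∂μ < ⊤ := by
  have hpt : ∀ x, ‖a x‖ₑ ^ 2 ≤ ENNReal.ofReal (C ^ 2) * ‖b x‖ₑ ^ 2 := by
    intro x
    have hC : ‖a x‖ ≤ |C| * ‖b x‖ :=
      (h x).trans (mul_le_mul_of_nonneg_right (le_abs_self C) (norm_nonneg _))
    rw [← ofReal_norm, ← ofReal_norm, ← ENNReal.ofReal_pow (norm_nonneg _),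
      ← ENNReal.ofReal_pow (norm_nonneg _), ← ENNReal.ofReal_mul (sq_nonneg _)]
    refine ENNReal.ofReal_le_ofReal ?_
    calc ‖a x‖ ^ 2 ≤ (|C| * ‖b x‖) ^ 2 := pow_le_pow_left₀ (norm_nonneg _) hC 2
      _ = C ^ 2 * ‖b x‖ ^ 2 := by rw [mul_pow, sq_abs]
  calc ∫⁻ x, ‖a x‖ₑ ^ 2 ∂μ ≤ ∫⁻ x, ENNReal.ofReal (C ^ 2) * ‖b x‖ₑ ^ 2 ∂μ := lintegral_mono hpt
    _ = ENNReal.ofReal (C ^ 2) * ∫⁻ x, ‖b x‖ₑ ^ 2 ∂μ :=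
        lintegral_const_mul' _ _ ENNReal.ofReal_ne_top
    _ < ⊤ := ENNReal.mul_lt_top ENNReal.ofReal_lt_top hb

/-- A continuous field dominated by `C ‖a‖ ‖b‖` with `a, b` continuous and square integrable is
integrable on `ℝ³`. [folklore] -/
theorem integrable_of_norm_le_const_mul_mul {G G₁ G₂ : Type*} [NormedAddCommGroup G]
    [NormedAddCommGroup G₁] [NormedSpace ℝ G₁] [NormedAddCommGroup G₂]
    {φ : EuclideanSpace ℝ (Fin 3) → G} {a : EuclideanSpace ℝ (Fin 3) → G₁}
    {b : EuclideanSpace ℝ (Fin 3) → G₂} (C : ℝ) (hφ : Continuous φ) (ha : Continuous a)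
    (hb : Continuous b) (ha2 : ∫⁻ x, ‖a x‖ₑ ^ 2 < ⊤) (hb2 : ∫⁻ x, ‖b x‖ₑ ^ 2 < ⊤)
    (hle : ∀ x, ‖φ x‖ ≤ C * ‖a x‖ * ‖b x‖) : Integrable φ volume := by
  have ha2' : ∫⁻ x, ‖C • a x‖ₑ ^ 2 < ⊤ :=
    lintegral_enorm_sq_lt_top_of_norm_le_const_mul |C|
      (fun x => by rw [norm_smul, Real.norm_eq_abs]) ha2
  refine integrable_of_norm_le_mul_of_lintegral_sq (a := fun x => C • a x) hφ.aestronglyMeasurable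
    (ha.const_smul C) hb ha2' hb2 fun x => ?_
  rw [norm_smul, Real.norm_eq_abs]
  exact (hle x).trans (mul_le_mul_of_nonneg_right
    (mul_le_mul_of_nonneg_right (le_abs_self C) (norm_nonneg _)) (norm_nonneg _))

end WeightedSlice

/-- **Registered sub-goal of `stub_weightedVorticitySlice` (tools file): the pointwise Young
budget**, `WeightedSlice.pointwise_budget` in closed form. [folklore] -/
theorem stub_weightedVorticitySlice_pointwise :
    ∀ ⦃ν : ℝ⦄, 0 < ν →
    ∀ (L : EuclideanSpace ℝ (Fin 3) →L[ℝ] EuclideanSpace ℝ (Fin 3)) (y V : EuclideanSpace ℝ (Fin 3)),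
      -(ν * ∑ i, ⟪L (EuclideanSpace.basisFun (Fin 3) ℝ i),
          (‖y‖ ^ 2 + 1) ^ (1 / 4 : ℝ) • L (EuclideanSpace.basisFun (Fin 3) ℝ i) +
            ((‖y‖ ^ 2 + 1) ^ (1 / 4 : ℝ) / (2 * (‖y‖ ^ 2 + 1)) *
              ⟪y, L (EuclideanSpace.basisFun (Fin 3) ℝ i)⟫) • y⟫ +
        ⟪(‖y‖ ^ 2 + 1) ^ (1 / 4 : ℝ) • L y +
            ((‖y‖ ^ 2 + 1) ^ (1 / 4 : ℝ) / (2 * (‖y‖ ^ 2 + 1)) * ⟪y, L y⟫) • y, V⟫) ≤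
      3 / (8 * ν) * (‖V‖ ^ 2 * ((‖y‖ ^ 2 + 1) ^ (1 / 4 : ℝ) * ‖y‖ ^ 2)) :=
  fun _ hν L y V => WeightedSlice.pointwise_budget hν L y V

end Summit.NavierStokesRegularity.NavierStokesRegularity.Theorems.RungReynoldsOne

end
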